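import Summits.QuantumFields.BalabanUV.T4Continuum.Spine.NE1p.DressedRebornMuPart
import Summits.QuantumFields.BalabanUV.T4Continuum.Spine.NE1p.DressedSmallFieldOnCoresSlotLetters

/-!
# T⁴ programme, spine estimate NE1′ (node O3b/H2) — THE RE-BORN μ-PART AT THE SUBSTRATE'S SLOT LETTERS AND AT THE GAUSSIAN LETTERS
# OF RECORD: S56 §3's bi-pencil END `‖E(μ,1) − E(0,1) − E(μ,0) + E(0,0)‖ ≤ 2·((2M∕μ₁)·‖μ‖)∕ε·‖v‖` for the slot activities
# `Σ actOfLetters ℓ … o (h₀ + μ • u + s • v)` (`hact` BY `rfl`) and at `ℓ := coreLettersOf A` with N0r's operator-letter blocks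
# DISCHARGED by S30 §1 — S33 §4 ∕ S46 §2 ∕ S52-A §2–§3's junction pattern VERBATIM, for the DRESSED (bilinear) regeneration END

Cell `pub-balaban`, sub-cell `t4`, BINDER-OWNERS row NE1′; NE1′ formalisation crew, unit `b2b-balaban-t4-ne1p-formalise-leaf-03`
(LEAF PROVER 03, generation 14); crew row S63 ∕ DAG N29zzzzzc of `t4/formal/NE1p/LEAVES.md`
(BOOKED typer R-T150; read X233 ok) (own-lineage follower of S56 `DressedRebornMuPart`
(p239964): its letters column, as S52-A §2∕§3 are S52-A §1's and S46 §1∕§2 are S33 §3's).  ADDITIVE — imports S56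
`Spine/NE1p/DressedRebornMuPart` + S30-letters `Spine/NE1p/DressedSmallFieldOnCoresSlotLetters` ONLY; THEOREMS ONLY (0 def, 0
`def … : Prop`, 0 cite); nothing restated.

WHY THIS FILE.  S56 §3 `rebornMuPart_locE_le_of_coresAt_bipencil_mass` types the dressed (w5) END for ABSTRACT cores `𝔊 k i X` with an
abstract activity `act` identified on the bidisc by `hact`.  The substrate's dressed activities are the slot activities `actOfLetters ℓ Z j
o h = (coreOf ℓ Z j).termAt o h` (by `rfl`), and the Gaussian letters of record are `coreLettersOf A` whose three operator-letter blocks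
`hm` ∕ `hN` ∕ `hq` S30 §1 DISCHARGES from primitive letter conditions (`margin_pos` ∕ `hN_coreLettersOf` ∕ `hq_coreLettersOf`).  Every
other END of the column has been carried to these two levels (N0r §3 → S33 §4 → S46 §2; S52-A §2∕§3; S55 §3∕§4); the re-born μ-part had
not (`grep -n actOfLetters Spine/NE1p/DressedRebornMuPart*.lean` = ∅).  Here:
* §1 `rebornMuPart_locE_le_of_actOfLetters` (kernel; S56 §3 EXACTLY ONCE at the term index `Pol × J`, `𝔊 k p X := coreOf ℓ p.1 p.2`,
  `act z Z := Σ_{p ∈ terms Z} actOfLetters ℓ p.1 p.2 o (h₀ + z.1 • u + z.2 • v)`, `hact` BY `rfl`): the mixed second difference over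
  `{0, μ} × {0, 1}` of the slot activities' dressed output, written LITERALLY at the four corners of the bi-pencil, is
  `≤ 2·((2M∕μ₁)·‖μ‖)∕ε·‖v‖`, `M = e·ν·c₁·K₀²·A·e^{−r₁ d(X₀)}`.
* §2 `rebornMuPart_locE_le_of_coreLettersOf` (kernel; §1 EXACTLY ONCE at `ℓ := coreLettersOf D P Op 𝒵 dom Jc V mI A` with the explicit
  letters `N₀ := gaussC·√(max 1 (card!·β₀^{card} + d₀))`, `mq := (γ − card·ϑ·R′)/2`, `bq := 0` and S30 §1's three blocks BY NAME —
  S52-A §3's substitution VERBATIM).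

WHAT STAYS DISPLAYED (binders, by name; NOTHING instantiated on Bałaban's densities): `hroom` (+ `0 ≤ R′ k` in §2); the Gaussian letter
blocks (§1) resp. the substrate's primitive letter conditions `hbase` ∕ `hrdm` ∕ `hβ₀` ∕ `hd₀` ∕ `hrd`, centre conditions `hctr`, radius
smallnesses `hbud` ∕ `hmq` (§2); `hO` ∕ `hH` with room for BOTH directions (`‖h₀ − ctr.2‖ + μ₁‖u‖ + ε ≤ RHist k`); (B1b)'s residue
`terms` ∕ `emb` ∕ `hscale`; the clause SHAPES; (B3) = `hM3` (G-ne9p2-5, UNPRINTED, shared with NE9, a BINDER); the source radius `μ₁`, the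
content direction `v` with `0 < ‖v‖ < ε`, the point `μ ∈ ball 0 μ₁`.  `4M∕(μ₁ε)` = a READING of the dressed (w5) constant at the
letters (the (w5)∕allowance constants are the cell's readings — owner g31 l.21941 ∕ l.22720); (B1a) discharged at the letters, (w5)∕(w6)
NOT discharged on Bałaban's densities.

HONEST FRAMING.  By-name junctions over SHAPES (S56 §3 at the substrate's slot letters; S30 §1's letter blocks; (B1a) relocated onto row
NE5's exp-linear FORMAT hypothesis — identification with Bałaban's (2.14) = the substrate's DISPLAYED reading, NOT claimed); (B1b) ∕ (B3)
∕ (B5) NOT discharged; 0 binders instantiated on Bałaban's densities; no new inequality; no wall item of NE1′ or NE5 moves; the NE1′ wall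
wording of record v1.8 (T4-DAG v48) — words, not kind — does NOT move; R-t4r2-Q2 NOT met; ABSOLUTE RULE honoured ([folklore] kernel
lemmas only; no numeral of print; no disputed step of the audited manuscripts enters as a fact).  NE1′ ⇐ the named binders — NOT
proved, NOT printed; spine PROVED 0∕9; count 9 unchanged.  Rung (B)+1 on ONE finite four-torus — NOT infinite volume, NOT a mass gap,
NOT OS on ℝ⁴, NOT Clay.  HONEST DEPENDENCY: continuum YM on T⁴ ⇐ BetaPertH ∧ nine spine estimates (0/9 proved); BetaPertH ⇐ (D1) ∧
(D4) ∧ CAP+tail; G-an2-4 gates asym, D1 and NE2/3/4.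
-/

noncomputable section

namespace Summit.QuantumFields.BalabanUV.T4Continuum.NE1p.DressedRebornMuPartSlotLetters

open scoped BigOperators Matrix
open Metric Set MeasureTheory
open Literature.MathematicalPhysics.QuantumFieldTheory.Balaban1983to89
open Literature.MathematicalPhysics.QuantumFieldTheory.Balaban1983to89.T4OutputRate (Carriers)
open Literature.MathematicalPhysics.QuantumFieldTheory.Balaban1983to89.B13Resummation (locE Geometry)
open Literature.MathematicalPhysics.QuantumFieldTheory.Balaban1983to89.B5Prop11Lower (nsq)
open Summit.QuantumFields.BalabanUV.T4Continuum.B13HistMeasurable (MeasPotFrame B13HistM)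
open Summit.QuantumFields.BalabanUV.T4Continuum.SubstrateTwoRunsDriven (DrivenRuns)
open Summit.QuantumFields.BalabanUV.T4Continuum.SubstrateActivities (CoreLetters coreOf actOfLetters)
open Summit.QuantumFields.BalabanUV.T4Continuum.SubstrateGaussianLetters (gaussC linForm)
open Summit.QuantumFields.BalabanUV.T4Continuum.SubstrateGaussianLettersBall (detBudget)
open Summit.QuantumFields.BalabanUV.T4Continuum.SubstrateSlotsOfRecord (ActLetters coreLettersOf)
open Summit.QuantumFields.BalabanUV.T4Continuum.NE1p.DressedSmallFieldOnCoresSlotLetters (margin_pos hN_coreLettersOf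
  hq_coreLettersOf)
open Summit.QuantumFields.BalabanUV.T4Continuum.NE1p.DressedRebornMuPart (rebornMuPart_locE_le_of_coresAt_bipencil_mass)

/-! ## §1 AT THE SUBSTRATE'S LETTERS: the slot activities `actOfLetters ℓ` along the bi-pencil — `hact` BY `rfl` -/

section Slot
variable {C : Carriers} (P : MeasPotFrame C) (Op : Type*) [NormedAddCommGroup Op] [NormedSpace ℂ Op] {Pol J : Type*}
  (𝒴 : Pol → J → Type) [∀ Z j, Fintype (𝒴 Z j)] (dom : ∀ Z j, 𝒴 Z j → C.Dom)
  (Jc : Pol → J → Type) [∀ Z j, Fintype (Jc Z j)]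
  (V : Pol → J → Type) [∀ Z j, NormedAddCommGroup (V Z j)] [∀ Z j, InnerProductSpace ℝ (V Z j)]
  [∀ Z j, MeasurableSpace (V Z j)] [∀ Z j, BorelSpace (V Z j)] [∀ Z j, FiniteDimensional ℝ (V Z j)]
variable (D : LocDomainSys) {Cube : Type} [DecidableEq Cube] (G : Geometry D Cube)

open Classical in
/-- **THE RE-BORN μ-PART OF THE DRESSED OUTPUT OF THE SUBSTRATE'S SLOT ACTIVITIES** (kernel; S56 §3 at the term index `Pol × J`,
`𝔊 k p X := coreOf ℓ p.1 p.2`, dressed activity of the polymer `Z` along the bi-pencil := `Σ_{p ∈ terms Z} actOfLetters ℓ p.1 p.2 o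
(h₀ + z.1 • u + z.2 • v)` — `hact` BY `rfl`; S33 §4 ∕ S52-A §2's pattern).  Binders = S52-A §2 `regenPart_locE_le_of_actOfLetters`'s with
the strength pencil replaced by the bi-pencil: MINUS [`ϱ`, `hϱ`] PLUS [`u`, `μ₁`, `ε`, `hv : 0 < ‖v‖`, `hvε : ‖v‖ < ε`, `μ`,
`hμ : μ ∈ ball 0 μ₁`], `hH` ∕ `hM3` with room `μ₁‖u‖ + ε`.  Conclusion: the mixed difference over `{0, μ} × {0, 1}` — written
LITERALLY at the four corners — is `≤ 2·((2M∕μ₁)·‖μ‖)∕ε·‖v‖`. [folklore] -/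
theorem rebornMuPart_locE_le_of_actOfLetters {W : Set (ℕ → ℝ)} {ctr : ℕ → (ℕ → ℝ) → C.BgB → Op × B13HistM P}
    {ROp RHist R' : ℕ → ℝ} (ℓ : ∀ Z j, CoreLetters P Op 𝒴 dom Jc V Z j) {mq bq N₀ : ℕ → Pol × J → C.Dom → ℝ}
    (hroom : ∀ k, ROp k < R' k) (hm : ∀ k, ∀ g ∈ W, ∀ (U : C.BgB) (X : C.Dom), C.scale X = k → ∀ p, 0 < mq k p X)
    (hN : ∀ k, ∀ g ∈ W, ∀ (U : C.BgB) (X : C.Dom), C.scale X = k → ∀ p : Pol × J,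
      (∀ o ∈ ball (ctr k g U).1 (R' k),
        AEStronglyMeasurable ((ℓ p.1 p.2).N o) (coreOf P Op 𝒴 dom Jc V ℓ p.1 p.2).lam) ∧
      (∀ a, DifferentiableOn ℂ (fun o => (ℓ p.1 p.2).N o a) (ball (ctr k g U).1 (R' k))) ∧
      (∀ o ∈ ball (ctr k g U).1 (R' k), ∀ a, ‖(ℓ p.1 p.2).N o a‖ ≤ N₀ k p X))
    (hq : ∀ k, ∀ g ∈ W, ∀ (U : C.BgB) (X : C.Dom), C.scale X = k → ∀ p : Pol × J,
      (∀ o ∈ ball (ctr k g U).1 (R' k),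
        AEStronglyMeasurable (Function.uncurry ((ℓ p.1 p.2).q o))
          ((coreOf P Op 𝒴 dom Jc V ℓ p.1 p.2).lam.prod volume)) ∧
      (∀ a v, DifferentiableOn ℂ (fun o => (ℓ p.1 p.2).q o a v) (ball (ctr k g U).1 (R' k))) ∧
      (∀ o ∈ ball (ctr k g U).1 (R' k), ∀ a v, mq k p X * ‖v‖ ^ 2 - bq k p X ≤ ((ℓ p.1 p.2).q o a v).re))
    {k : ℕ} {g : ℕ → ℝ} (hg : g ∈ W) {U : C.BgB} {o : Op} {h₀ u v : B13HistM P} {μ₁ ε : ℝ}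
    (hv : 0 < ‖v‖) (hvε : ‖v‖ < ε)
    (hO : ‖o - (ctr k g U).1‖ ≤ ROp k) (hH : ‖h₀ - (ctr k g U).2‖ + μ₁ * ‖u‖ + ε ≤ RHist k)
    {emb : D.Dom → C.Dom} (hscale : ∀ Z, C.scale (emb Z) = k) (terms : D.Dom → Finset (Pol × J))
    {A R r₁ b₅ : ℝ} {X₀ : D.Dom} (hA : 0 ≤ A) (hr₁ : 0 ≤ r₁) (hb : r₁ * 5 ≤ b₅)
    (hrate : r₁ + 2 * G.κ₀ + 2 ≤ R) (hsmall : A * Real.exp (b₅ + 1) * G.K₀ * G.ν * G.c₁ ≤ 1) (hM3 : ∀ Z, G.cubes Z ⊆ G.cubes X₀ →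
      ∑ p ∈ terms Z, (coreOf P Op 𝒴 dom Jc V ℓ p.1 p.2).lam.real univ *
          ((coreOf P Op 𝒴 dom Jc V ℓ p.1 p.2).wB * N₀ k p (emb Z) * Real.exp (bq k p (emb Z))) *
          (Real.pi / (mq k p (emb Z) / 2)) ^ (Module.finrank ℝ (V p.1 p.2) / 2 : ℝ) *
        Real.exp ((coreOf P Op 𝒴 dom Jc V ℓ p.1 p.2).N₁ * (‖h₀‖ + μ₁ * ‖u‖ + ε)) ≤ A * Real.exp (-(R * D.dj Z)))
    {μ : ℂ} (hμ : μ ∈ ball (0 : ℂ) μ₁) :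
    ‖locE G.ι G.cubes (fun Z => ∑ p ∈ terms Z, actOfLetters P Op 𝒴 dom Jc V ℓ p.1 p.2 o (h₀ + μ • u + (1 : ℂ) • v)) (G.cubes X₀) -
        locE G.ι G.cubes (fun Z => ∑ p ∈ terms Z, actOfLetters P Op 𝒴 dom Jc V ℓ p.1 p.2 o (h₀ + (0 : ℂ) • u + (1 : ℂ) • v))
          (G.cubes X₀) -
        (locE G.ι G.cubes (fun Z => ∑ p ∈ terms Z, actOfLetters P Op 𝒴 dom Jc V ℓ p.1 p.2 o (h₀ + μ • u + (0 : ℂ) • v))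
            (G.cubes X₀) -
          locE G.ι G.cubes (fun Z => ∑ p ∈ terms Z, actOfLetters P Op 𝒴 dom Jc V ℓ p.1 p.2 o (h₀ + (0 : ℂ) • u + (0 : ℂ) • v))
            (G.cubes X₀))‖ ≤
      2 * (2 * (Real.exp 1 * G.ν * G.c₁ * G.K₀ ^ 2 * A * Real.exp (-(r₁ * D.dj X₀))) / μ₁ * ‖μ‖) / ε * ‖v‖ :=
  rebornMuPart_locE_le_of_coresAt_bipencil_mass D G (ι := Pol × J)
    (fun (_ : ℕ) (p : Pol × J) (_ : C.Dom) => coreOf P Op 𝒴 dom Jc V ℓ p.1 p.2) hroom hm hN hq hg hv hvε hO hH hscale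
    (terms := terms)
    (act := fun z Z => ∑ p ∈ terms Z, actOfLetters P Op 𝒴 dom Jc V ℓ p.1 p.2 o (h₀ + z.1 • u + z.2 • v))
    (fun _ _ _ => rfl) hA hr₁ hb hrate hsmall hM3 hμ

end Slot

/-! ## §2 AT THE GAUSSIAN LETTERS OF RECORD `coreLettersOf A`, N0r's operator-letter blocks DISCHARGED by S30 §1 -/

section CoreLettersOf

variable {G : Type} [GaugeGroup G] (D : DrivenRuns G) (P : MeasPotFrame D.carriers)
variable (Op : Type) [NormedAddCommGroup Op] [NormedSpace ℂ Op] {J : Type}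
  (𝒵 : D.carriers.Dom → J → Type) [∀ Z j, Fintype (𝒵 Z j)] (dom : ∀ Z j, 𝒵 Z j → D.carriers.Dom)
  (Jc : D.carriers.Dom → J → Type) [∀ Z j, Fintype (Jc Z j)]
  (V : D.carriers.Dom → J → Type) [∀ Z j, NormedAddCommGroup (V Z j)] [∀ Z j, InnerProductSpace ℝ (V Z j)]
  [∀ Z j, MeasurableSpace (V Z j)] [∀ Z j, BorelSpace (V Z j)] [∀ Z j, FiniteDimensional ℝ (V Z j)]
  (mI : D.carriers.Dom → J → Type) [∀ Z j, Fintype (mI Z j)] [∀ Z j, DecidableEq (mI Z j)]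
variable (𝔇 : LocDomainSys) {Cube : Type} [DecidableEq Cube] (Ge : Geometry 𝔇 Cube)

open Classical in
/-- **THE RE-BORN μ-PART OF THE DRESSED OUTPUT OF THE SLOT ACTIVITIES AT THE CORE LETTERS OF RECORD, OPERATOR LETTERS DISCHARGED**
(kernel; §1 ONCE BY NAME at `ℓ := coreLettersOf D P Op 𝒵 dom Jc V mI A`, letters `N₀ k p X := gaussC (mI p.1 p.2)·√(max 1 (card!·β₀^{card}
+ d₀))`, `mq k p X := (γ − card·ϑ·R′ k)/2`, `bq := 0`, blocks `hm` ∕ `hN` ∕ `hq` from S30 §1 `margin_pos` ∕ `hN_coreLettersOf` ∕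
`hq_coreLettersOf` — S52-A §3's substitution VERBATIM).  Binders = S52-A §3 `regenPart_locE_le_of_coreLettersOf`'s with the strength pencil
replaced by the bi-pencil (MINUS [`ϱ`, `hϱ`] PLUS [`u`, `μ₁`, `ε`, `hv`, `hvε`, `μ`, `hμ`]).  Nothing of the substrate's data is
asserted. [folklore] -/
theorem rebornMuPart_locE_le_of_coreLettersOf {W : Set (ℕ → ℝ)} {ctr : ℕ → (ℕ → ℝ) → D.carriers.BgB → Op × B13HistM P}
    {ROp RHist R' : ℕ → ℝ} (A : ∀ Z j, ActLetters D P Op 𝒵 dom Jc V mI Z j) {β₀ ϑ d₀ γ : D.carriers.Dom → J → ℝ}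
    (hroom : ∀ k, ROp k < R' k) (hR' : ∀ k, 0 ≤ R' k)
    (hbase : ∀ Z j ii jj, Measurable fun a => (A Z j).base a ii jj)
    (hrdm : ∀ Z j ii jj (o' : Op), Measurable fun a => (A Z j).rd a ii jj o')
    (hβ₀ : ∀ Z j, 0 ≤ β₀ Z j) (hd₀ : ∀ Z j, 0 < d₀ Z j)
    (hrd : ∀ Z j a ii jj, ‖(A Z j).rd a ii jj‖ ≤ ϑ Z j)
    (hctr : ∀ k, ∀ g ∈ W, ∀ (U : D.carriers.BgB) (Z : D.carriers.Dom) (j : J) (a : (Jc Z j ⊕ 𝒵 Z j) → ℝ × ℝ),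
      (∀ ii jj, ‖linForm (A Z j).base (A Z j).rd (ctr k g U).1 a ii jj‖ ≤ β₀ Z j) ∧
      ((linForm (A Z j).base (A Z j).rd (ctr k g U).1 a).det).im = 0 ∧ d₀ Z j ≤ ((linForm (A Z j).base (A Z j).rd (ctr k g U).1 a).det).re ∧
      (∀ x : mI Z j → ℂ, γ Z j * nsq x ≤ (star x ⬝ᵥ (linForm (A Z j).base (A Z j).rd (ctr k g U).1 a *ᵥ x)).re))
    (hbud : ∀ k Z j, detBudget (Fintype.card (mI Z j)) (β₀ Z j) (ϑ Z j) (R' k) < d₀ Z j)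
    (hmq : ∀ k Z j, Fintype.card (mI Z j) * ϑ Z j * R' k < γ Z j)
    {k : ℕ} {g : ℕ → ℝ} (hg : g ∈ W) {U : D.carriers.BgB} {o : Op} {h₀ u v : B13HistM P} {μ₁ ε : ℝ}
    (hv : 0 < ‖v‖) (hvε : ‖v‖ < ε)
    (hO : ‖o - (ctr k g U).1‖ ≤ ROp k) (hH : ‖h₀ - (ctr k g U).2‖ + μ₁ * ‖u‖ + ε ≤ RHist k)
    {emb : 𝔇.Dom → D.carriers.Dom} (hscale : ∀ Z, D.carriers.scale (emb Z) = k)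
    (terms : 𝔇.Dom → Finset (D.carriers.Dom × J))
    {A' R r₁ b₅ : ℝ} {X₀ : 𝔇.Dom} (hA : 0 ≤ A') (hr₁ : 0 ≤ r₁) (hb : r₁ * 5 ≤ b₅)
    (hrate : r₁ + 2 * Ge.κ₀ + 2 ≤ R) (hsmall : A' * Real.exp (b₅ + 1) * Ge.K₀ * Ge.ν * Ge.c₁ ≤ 1)
    (hM3 : ∀ Z, Ge.cubes Z ⊆ Ge.cubes X₀ →
      ∑ p ∈ terms Z, (coreOf P Op 𝒵 dom Jc V (coreLettersOf D P Op 𝒵 dom Jc V mI A) p.1 p.2).lam.real univ *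
          ((coreOf P Op 𝒵 dom Jc V (coreLettersOf D P Op 𝒵 dom Jc V mI A) p.1 p.2).wB *
              (gaussC (mI p.1 p.2) * Real.sqrt (max 1 ((Fintype.card (mI p.1 p.2)).factorial *
                β₀ p.1 p.2 ^ Fintype.card (mI p.1 p.2) + d₀ p.1 p.2))) * Real.exp 0) *
          (Real.pi / ((γ p.1 p.2 - Fintype.card (mI p.1 p.2) * ϑ p.1 p.2 * R' k) / 2 / 2)) ^ (Module.finrank ℝ (V p.1 p.2) / 2 : ℝ) *
        Real.exp ((coreOf P Op 𝒵 dom Jc V (coreLettersOf D P Op 𝒵 dom Jc V mI A) p.1 p.2).N₁ * (‖h₀‖ + μ₁ * ‖u‖ + ε)) ≤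
        A' * Real.exp (-(R * 𝔇.dj Z)))
    {μ : ℂ} (hμ : μ ∈ ball (0 : ℂ) μ₁) :
    ‖locE Ge.ι Ge.cubes (fun Z => ∑ p ∈ terms Z,
          actOfLetters P Op 𝒵 dom Jc V (coreLettersOf D P Op 𝒵 dom Jc V mI A) p.1 p.2 o (h₀ + μ • u + (1 : ℂ) • v)) (Ge.cubes X₀) -
        locE Ge.ι Ge.cubes (fun Z => ∑ p ∈ terms Z,
          actOfLetters P Op 𝒵 dom Jc V (coreLettersOf D P Op 𝒵 dom Jc V mI A) p.1 p.2 o (h₀ + (0 : ℂ) • u + (1 : ℂ) • v))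
          (Ge.cubes X₀) -
        (locE Ge.ι Ge.cubes (fun Z => ∑ p ∈ terms Z,
            actOfLetters P Op 𝒵 dom Jc V (coreLettersOf D P Op 𝒵 dom Jc V mI A) p.1 p.2 o (h₀ + μ • u + (0 : ℂ) • v))
            (Ge.cubes X₀) -
          locE Ge.ι Ge.cubes (fun Z => ∑ p ∈ terms Z,
            actOfLetters P Op 𝒵 dom Jc V (coreLettersOf D P Op 𝒵 dom Jc V mI A) p.1 p.2 o (h₀ + (0 : ℂ) • u + (0 : ℂ) • v))
            (Ge.cubes X₀))‖ ≤
      2 * (2 * (Real.exp 1 * Ge.ν * Ge.c₁ * Ge.K₀ ^ 2 * A' * Real.exp (-(r₁ * 𝔇.dj X₀))) / μ₁ * ‖μ‖) / ε * ‖v‖ :=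
  rebornMuPart_locE_le_of_actOfLetters P Op 𝒵 dom Jc V 𝔇 Ge (coreLettersOf D P Op 𝒵 dom Jc V mI A)
    (mq := fun k p _ => (γ p.1 p.2 - Fintype.card (mI p.1 p.2) * ϑ p.1 p.2 * R' k) / 2) (bq := fun _ _ _ => 0)
    (N₀ := fun _ p _ => gaussC (mI p.1 p.2) *
      Real.sqrt (max 1 ((Fintype.card (mI p.1 p.2)).factorial * β₀ p.1 p.2 ^ Fintype.card (mI p.1 p.2) + d₀ p.1 p.2)))
    hroom (margin_pos D mI hmq) (hN_coreLettersOf D P Op 𝒵 dom Jc V mI A hR' hbase hrdm hβ₀ hd₀ hrd hctr hbud)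
    (hq_coreLettersOf D P Op 𝒵 dom Jc V mI A hbase hrdm hrd hctr) hg hv hvε hO hH hscale terms hA hr₁ hb hrate hsmall hM3 hμ

end CoreLettersOf

end Summit.QuantumFields.BalabanUV.T4Continuum.NE1p.DressedRebornMuPartSlotLetters

end
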